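import Mathlib
import Summits.Ventures.PercRepro2.CoinChainCleanBaseChain

/-!
# The clean-state base bound, `x`-layer cake (the mirror)
(blind cell PercRepro2, night-2 g23; proofs/NIGHT2-DARC.md §63.13)

`gate_functional_ge_baseX`: the mirror of `gate_functional_ge_baseY` under `x ↔ y`
(`(Λ Nx∅ − Λ₁ N∅)·(Λ ∑G'y − Λ₂ ∑G') ≤ N∅·T(G, G')`), and the pure-chain consequences
`pureChain_U111_ge_baseX` (`m·U111 ≥ (b0 xI − m b1)(b0 g2 − b2 g0)`) and
`pureChain_functional_nonneg_of_cslBaseX` (the pure chain at EVERY `ρ ∈ [0, 1]` whenever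
`a0²·(b0 xI − m b1)(b0 g2 − b2 g0) + m·(b0 − g0)·Δ ≥ 0` — the gate LOWERS the `y`-mean and the
product of the ideal `x`-shift with the gate's `y`-deficit pays the pivotal need).
-/

namespace Summit.Ventures.PercRepro2.Coin

open Classical

section CleanBaseX

variable {V : Type*} [DecidableEq V] {R : Type*} [Field R] [LinearOrder R] [IsStrictOrderedRing R]

/-- **The quantitative clean-state theorem, `x`-layer cake.** -/
theorem gate_functional_ge_baseX (U ent : Finset V) (G G' x y : Finset V → R)
    (hG : ∀ W, 0 ≤ G W) (hG' : ∀ W, 0 ≤ G' W)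
    (hx0 : ∀ W, 0 ≤ x W) (hy0 : ∀ W, 0 ≤ y W)
    (hxm : ∀ s t, x s ≤ x (s ∪ t)) (hym : ∀ s t, y s ≤ y (s ∪ t))
    (wLL : ∀ s ⊆ U, ∀ t ⊆ U, G s * G t ≤ G (s ∩ t) * G (s ∪ t))
    (wMM : ∀ s ⊆ U, ∀ t ⊆ U, G' s * G' t ≤ G' (s ∩ t) * G' (s ∪ t))
    (wML : ∀ s ⊆ U, ∀ t ⊆ U, (∃ r ∈ ent, r ∈ s) → G' s * G t ≤ G (s ∩ t) * G' (s ∪ t))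
    (hI : ∀ W, W ∩ ent = ∅ → G' W = G W) :
    ((∑ W ∈ U.powerset, G W) * (∑ W ∈ U.powerset.filter (fun W => W ∩ ent = ∅), G' W * x W)
        - (∑ W ∈ U.powerset, G W * x W) * (∑ W ∈ U.powerset.filter (fun W => W ∩ ent = ∅), G' W)) *
      ((∑ W ∈ U.powerset, G W) * (∑ W ∈ U.powerset, G' W * y W)
        - (∑ W ∈ U.powerset, G W * y W) * (∑ W ∈ U.powerset, G' W)) ≤
    (∑ W ∈ U.powerset.filter (fun W => W ∩ ent = ∅), G' W) *
      ((∑ W ∈ U.powerset, G W) ^ 2 * (∑ W ∈ U.powerset, G' W * (x W * y W))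
        - (∑ W ∈ U.powerset, G W) * (∑ W ∈ U.powerset, G W * x W) *
          (∑ W ∈ U.powerset, G' W * y W)
        - (∑ W ∈ U.powerset, G W) * (∑ W ∈ U.powerset, G W * y W) *
          (∑ W ∈ U.powerset, G' W * x W)
        + (∑ W ∈ U.powerset, G W * x W) * (∑ W ∈ U.powerset, G W * y W) *
          (∑ W ∈ U.powerset, G' W)) := by
  have h := gate_functional_ge_baseY U ent G G' y x hG hG' hy0 hx0 hym hxm wLL wMM wML hI
  have e : (∑ W ∈ U.powerset, G' W * (y W * x W)) = ∑ W ∈ U.powerset, G' W * (x W * y W) :=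
    Finset.sum_congr rfl fun W _ => by ring
  rw [e] at h
  linarith [h]

/-- **The clean-state base bound for the pure chain, `x`-layer cake**:
`m·U111 ≥ (b0 xI − m b1)·(b0 g2 − b2 g0)`. -/
theorem pureChain_U111_ge_baseX (U ent' : Finset V) (ν c d d' : Finset V → R)
    (hν0 : ∀ W, 0 ≤ ν W)
    (hν : ∀ s ⊆ U, ∀ t ⊆ U, ν s * ν t ≤ ν (s ∩ t) * ν (s ∪ t))
    (hc0 : ∀ W, 0 ≤ c W) (hd0 : ∀ W, 0 ≤ d W) (hd'0 : ∀ W, 0 ≤ d' W)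
    (hdc : ∀ W, d W ≤ c W) (hd'c : ∀ W, d' W ≤ c W)
    (hcc : ∀ s t, c s * c t ≤ c (s ∩ t) * c (s ∪ t))
    (hdd : ∀ s t, d s * d t ≤ d (s ∩ t) * d (s ∪ t))
    (hd'd' : ∀ s t, d' s * d' t ≤ d' (s ∩ t) * d' (s ∪ t))
    (hcd : ∀ s t, c s * d t ≤ c (s ∩ t) * d (s ∪ t))
    (hcd' : ∀ s t, c s * d' t ≤ c (s ∩ t) * d' (s ∪ t))
    (hdd' : ∀ s t, d s * d' t ≤ d (s ∩ t) * d' (s ∪ t))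
    (hratio : ∀ s t, s ⊆ t → d s * c t ≤ c s * d t)
    (hratio' : ∀ s t, s ⊆ t → d' s * c t ≤ c s * d' t)
    (x y : Finset V → R) (hx0 : ∀ W, 0 ≤ x W) (hy0 : ∀ W, 0 ≤ y W)
    (hxm : ∀ s t, x s ≤ x (s ∪ t)) (hym : ∀ s t, y s ≤ y (s ∪ t)) :
    ((∑ W ∈ U.powerset, ν W * chainMix ∅ ent' 1 c d W) *
        (∑ W ∈ U.powerset.filter (fun W => W ∩ ent' = ∅), ν W * c W * x W)
      - (∑ W ∈ U.powerset, ν W * chainMix ∅ ent' 1 c d W * x W) *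
        (∑ W ∈ U.powerset.filter (fun W => W ∩ ent' = ∅), ν W * c W)) *
      ((∑ W ∈ U.powerset, ν W * chainMix ∅ ent' 1 c d W) *
          (∑ W ∈ U.powerset, ν W * chainMix ∅ ent' 1 c d' W * y W)
        - (∑ W ∈ U.powerset, ν W * chainMix ∅ ent' 1 c d W * y W) *
          (∑ W ∈ U.powerset, ν W * chainMix ∅ ent' 1 c d' W)) ≤
    (∑ W ∈ U.powerset.filter (fun W => W ∩ ent' = ∅), ν W * c W) *
      ((∑ W ∈ U.powerset, ν W * chainMix ∅ ent' 1 c d W) ^ 2 *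
          (∑ W ∈ U.powerset, ν W * chainMix ∅ ent' 1 c d' W * (x W * y W))
        - (∑ W ∈ U.powerset, ν W * chainMix ∅ ent' 1 c d W) *
          (∑ W ∈ U.powerset, ν W * chainMix ∅ ent' 1 c d W * x W) *
          (∑ W ∈ U.powerset, ν W * chainMix ∅ ent' 1 c d' W * y W)
        - (∑ W ∈ U.powerset, ν W * chainMix ∅ ent' 1 c d W) *
          (∑ W ∈ U.powerset, ν W * chainMix ∅ ent' 1 c d W * y W) *
          (∑ W ∈ U.powerset, ν W * chainMix ∅ ent' 1 c d' W * x W)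
        + (∑ W ∈ U.powerset, ν W * chainMix ∅ ent' 1 c d W * x W) *
          (∑ W ∈ U.powerset, ν W * chainMix ∅ ent' 1 c d W * y W) *
          (∑ W ∈ U.powerset, ν W * chainMix ∅ ent' 1 c d' W)) := by
  have h := pureChain_U111_ge_baseY U ent' ν c d d' hν0 hν hc0 hd0 hd'0 hdc hd'c hcc hdd hd'd'
    hcd hcd' hdd' hratio hratio' y x hy0 hx0 hym hxm
  have e : (∑ W ∈ U.powerset, ν W * chainMix ∅ ent' 1 c d' W * (y W * x W)) =
      ∑ W ∈ U.powerset, ν W * chainMix ∅ ent' 1 c d' W * (x W * y W) :=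
    Finset.sum_congr rfl fun W _ => by ring
  rw [e] at h
  linarith [h]

/-- **THE UNIVERSAL PURE CHAIN FROM THE CLEAN-STATE BASE BOUND (`x`-layer cake).** -/
theorem pureChain_functional_nonneg_of_cslBaseX (U ent' : Finset V) (ν c d d' : Finset V → R)
    (ρ : R) (hρ0 : 0 ≤ ρ) (hρ1 : ρ ≤ 1) (hν0 : ∀ W, 0 ≤ ν W)
    (hν : ∀ s ⊆ U, ∀ t ⊆ U, ν s * ν t ≤ ν (s ∩ t) * ν (s ∪ t))
    (hc0 : ∀ W, 0 ≤ c W) (hd0 : ∀ W, 0 ≤ d W) (hd'0 : ∀ W, 0 ≤ d' W)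
    (hdc : ∀ W, d W ≤ c W) (hd'c : ∀ W, d' W ≤ c W)
    (hcc : ∀ s t, c s * c t ≤ c (s ∩ t) * c (s ∪ t))
    (hdd : ∀ s t, d s * d t ≤ d (s ∩ t) * d (s ∪ t))
    (hd'd' : ∀ s t, d' s * d' t ≤ d' (s ∩ t) * d' (s ∪ t))
    (hcd : ∀ s t, c s * d t ≤ c (s ∩ t) * d (s ∪ t))
    (hcd' : ∀ s t, c s * d' t ≤ c (s ∩ t) * d' (s ∪ t))
    (hdd' : ∀ s t, d s * d' t ≤ d (s ∩ t) * d' (s ∪ t))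
    (hratio : ∀ s t, s ⊆ t → d s * c t ≤ c s * d t)
    (hratio' : ∀ s t, s ⊆ t → d' s * c t ≤ c s * d' t)
    (x y : Finset V → R) (hx0 : ∀ W, 0 ≤ x W) (hy0 : ∀ W, 0 ≤ y W)
    (hxm : ∀ s t, x s ≤ x (s ∪ t)) (hym : ∀ s t, y s ≤ y (s ∪ t))
    (hpos0 : 0 < ∑ W ∈ U.powerset, ν W * c W)
    (hpos1 : 0 < ∑ W ∈ U.powerset, ν W * chainMix ∅ ent' 1 c d W)
    (hmI : 0 < ∑ W ∈ U.powerset.filter (fun W => W ∩ ent' = ∅), ν W * c W)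
    (hsign : 0 ≤ (∑ W ∈ U.powerset, ν W * c W) ^ 2 *
        (((∑ W ∈ U.powerset, ν W * chainMix ∅ ent' 1 c d W) *
            (∑ W ∈ U.powerset.filter (fun W => W ∩ ent' = ∅), ν W * c W * x W)
          - (∑ W ∈ U.powerset.filter (fun W => W ∩ ent' = ∅), ν W * c W) *
            (∑ W ∈ U.powerset, ν W * chainMix ∅ ent' 1 c d W * x W)) *
         ((∑ W ∈ U.powerset, ν W * chainMix ∅ ent' 1 c d W) *
            (∑ W ∈ U.powerset, ν W * chainMix ∅ ent' 1 c d' W * y W)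
          - (∑ W ∈ U.powerset, ν W * chainMix ∅ ent' 1 c d W * y W) *
            (∑ W ∈ U.powerset, ν W * chainMix ∅ ent' 1 c d' W)))
        + (∑ W ∈ U.powerset.filter (fun W => W ∩ ent' = ∅), ν W * c W) *
          (((∑ W ∈ U.powerset, ν W * chainMix ∅ ent' 1 c d W) -
              (∑ W ∈ U.powerset, ν W * chainMix ∅ ent' 1 c d' W)) *
            (((∑ W ∈ U.powerset, ν W * chainMix ∅ ent' 1 c d W) * (∑ W ∈ U.powerset, ν W * c W * x W)
                - (∑ W ∈ U.powerset, ν W * c W) * (∑ W ∈ U.powerset, ν W * chainMix ∅ ent' 1 c d W * x W)) *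
              ((∑ W ∈ U.powerset, ν W * chainMix ∅ ent' 1 c d W) * (∑ W ∈ U.powerset, ν W * c W * y W)
                - (∑ W ∈ U.powerset, ν W * c W) * (∑ W ∈ U.powerset, ν W * chainMix ∅ ent' 1 c d W * y W))))) :
    0 ≤ (∑ W ∈ U.powerset, ν W * chainMix ∅ ent' ρ c d W) ^ 2 *
          (∑ W ∈ U.powerset, ν W * chainMix ∅ ent' ρ c d' W * (x W * y W))
        - (∑ W ∈ U.powerset, ν W * chainMix ∅ ent' ρ c d W) *
          (∑ W ∈ U.powerset, ν W * chainMix ∅ ent' ρ c d W * x W) *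
          (∑ W ∈ U.powerset, ν W * chainMix ∅ ent' ρ c d' W * y W)
        - (∑ W ∈ U.powerset, ν W * chainMix ∅ ent' ρ c d W) *
          (∑ W ∈ U.powerset, ν W * chainMix ∅ ent' ρ c d W * y W) *
          (∑ W ∈ U.powerset, ν W * chainMix ∅ ent' ρ c d' W * x W)
        + (∑ W ∈ U.powerset, ν W * chainMix ∅ ent' ρ c d W * x W) *
          (∑ W ∈ U.powerset, ν W * chainMix ∅ ent' ρ c d W * y W) *
          (∑ W ∈ U.powerset, ν W * chainMix ∅ ent' ρ c d' W) := by
  have hbase := pureChain_U111_ge_baseX U ent' ν c d d' hν0 hν hc0 hd0 hd'0 hdc hd'c hcc hdd hd'd'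
    hcd hcd' hdd' hratio hratio' x y hx0 hy0 hxm hym
  have hsq : (∑ W ∈ U.powerset, ν W * chainMix ∅ ent' 1 c d W) ^ 2 =
      (∑ W ∈ U.powerset, ν W * chainMix ∅ ent' 1 c d W) * (∑ W ∈ U.powerset, ν W * chainMix ∅ ent' 1 c d W) :=
    sq _
  rw [hsq] at hbase
  -- the algebra of `qprime_of_cslBase_alg` with the roles of the markers exchanged
  have hQ : 0 ≤ (∑ W ∈ U.powerset, ν W * c W) ^ 2 *
        ((∑ W ∈ U.powerset, ν W * chainMix ∅ ent' 1 c d W) *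
            (∑ W ∈ U.powerset, ν W * chainMix ∅ ent' 1 c d W) *
            (∑ W ∈ U.powerset, ν W * chainMix ∅ ent' 1 c d' W * (x W * y W))
          - (∑ W ∈ U.powerset, ν W * chainMix ∅ ent' 1 c d W) *
            (∑ W ∈ U.powerset, ν W * chainMix ∅ ent' 1 c d W * y W) *
            (∑ W ∈ U.powerset, ν W * chainMix ∅ ent' 1 c d' W * x W)
          - (∑ W ∈ U.powerset, ν W * chainMix ∅ ent' 1 c d W) *
            (∑ W ∈ U.powerset, ν W * chainMix ∅ ent' 1 c d W * x W) *
            (∑ W ∈ U.powerset, ν W * chainMix ∅ ent' 1 c d' W * y W)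
          + (∑ W ∈ U.powerset, ν W * chainMix ∅ ent' 1 c d W * x W) *
            (∑ W ∈ U.powerset, ν W * chainMix ∅ ent' 1 c d W * y W) *
            (∑ W ∈ U.powerset, ν W * chainMix ∅ ent' 1 c d' W))
        + ((∑ W ∈ U.powerset, ν W * chainMix ∅ ent' 1 c d W) -
            (∑ W ∈ U.powerset, ν W * chainMix ∅ ent' 1 c d' W)) *
          (((∑ W ∈ U.powerset, ν W * chainMix ∅ ent' 1 c d W) * (∑ W ∈ U.powerset, ν W * c W * x W)
              - (∑ W ∈ U.powerset, ν W * c W) * (∑ W ∈ U.powerset, ν W * chainMix ∅ ent' 1 c d W * x W)) *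
            ((∑ W ∈ U.powerset, ν W * chainMix ∅ ent' 1 c d W) * (∑ W ∈ U.powerset, ν W * c W * y W)
              - (∑ W ∈ U.powerset, ν W * c W) * (∑ W ∈ U.powerset, ν W * chainMix ∅ ent' 1 c d W * y W))) := by
    have h1 := mul_le_mul_of_nonneg_left hbase (sq_nonneg (∑ W ∈ U.powerset, ν W * c W))
    have h2 : 0 ≤ (∑ W ∈ U.powerset.filter (fun W => W ∩ ent' = ∅), ν W * c W) * ((∑ W ∈ U.powerset, ν W * c W) ^ 2 *
        ((∑ W ∈ U.powerset, ν W * chainMix ∅ ent' 1 c d W) *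
            (∑ W ∈ U.powerset, ν W * chainMix ∅ ent' 1 c d W) *
            (∑ W ∈ U.powerset, ν W * chainMix ∅ ent' 1 c d' W * (x W * y W))
          - (∑ W ∈ U.powerset, ν W * chainMix ∅ ent' 1 c d W) *
            (∑ W ∈ U.powerset, ν W * chainMix ∅ ent' 1 c d W * y W) *
            (∑ W ∈ U.powerset, ν W * chainMix ∅ ent' 1 c d' W * x W)
          - (∑ W ∈ U.powerset, ν W * chainMix ∅ ent' 1 c d W) *
            (∑ W ∈ U.powerset, ν W * chainMix ∅ ent' 1 c d W * x W) *
            (∑ W ∈ U.powerset, ν W * chainMix ∅ ent' 1 c d' W * y W)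
          + (∑ W ∈ U.powerset, ν W * chainMix ∅ ent' 1 c d W * x W) *
            (∑ W ∈ U.powerset, ν W * chainMix ∅ ent' 1 c d W * y W) *
            (∑ W ∈ U.powerset, ν W * chainMix ∅ ent' 1 c d' W))
        + ((∑ W ∈ U.powerset, ν W * chainMix ∅ ent' 1 c d W) -
            (∑ W ∈ U.powerset, ν W * chainMix ∅ ent' 1 c d' W)) *
          (((∑ W ∈ U.powerset, ν W * chainMix ∅ ent' 1 c d W) * (∑ W ∈ U.powerset, ν W * c W * x W)
              - (∑ W ∈ U.powerset, ν W * c W) * (∑ W ∈ U.powerset, ν W * chainMix ∅ ent' 1 c d W * x W)) *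
            ((∑ W ∈ U.powerset, ν W * chainMix ∅ ent' 1 c d W) * (∑ W ∈ U.powerset, ν W * c W * y W)
              - (∑ W ∈ U.powerset, ν W * c W) * (∑ W ∈ U.powerset, ν W * chainMix ∅ ent' 1 c d W * y W)))) := by
      nlinarith [h1, hsign]
    exact (mul_nonneg_iff_of_pos_left hmI).mp h2
  exact pureChain_functional_nonneg_of_Qprime U ent' ν c d d' ρ hρ0 hρ1 hν0 hν hc0 hd0 hd'0 hdc hd'c
    hcc hdd hd'd' hcd hcd' hdd' hratio hratio' x y hx0 hy0 hxm hym hpos0 hpos1 hQ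

end CleanBaseX

end Summit.Ventures.PercRepro2.Coin
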